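/-
Copyright (c) 2026 the pub-hodgecm-mathlib formalisation cell (harness21).  Prover seat hodgecm-mathlib-K2E3-p17 (g8), Track B «K2-LIT» ∕ h413
(`stmt-HodgeConjecture-24833`), line `K2_E3_EllipticInputs`, leaf (nsc-S-A′) `sig_K2E3GL3PrincipalBlockStandardSpan`, H-layer tool brick ADD of the architect's
`MEMO-SA-architecture.v2.K2E3-p25-g2.md` §1 (architect K2E3-p25 (g2); dealer K2E3-plan (g4) D86).  2026-09-04.
-/
import Summits.HodgeConjecture.HodgeConjecture.Theorems.K2E3JacquetExponentMultiset       -- ★ E1a `finrank_weightSpace_eq_add_of_exact`, `_eq_of_linearEquiv`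
import Summits.HodgeConjecture.HodgeConjecture.Theorems.K2E3GLnPrincipalBlockEmbedding    -- ★ `levi_id_mul_comm`
import Literature.NumberTheory.Automorphic.JacquetGLFunctor                               -- ★ `jacquetGLMap`, `jacquetGLMap_injective`, `jacquetGLMap_surjective`
import Literature.NumberTheory.Automorphic.AdmissibleSubquotient                          -- ★ `IsSmooth.toRepresentation`, `range_subtypeIntertwiningMap_eq_ker_mkQ`
import HarnessLib

/-!
# Crux `H413` — leaf (nsc-S-A′), H-layer tool ADD: ADDITIVITY OF JACQUET MULTIPLICITIES along `0 → N → V → V ⁄ N → 0`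

Cell `hodgecm-mathlib`, Track B; THEOREMS ONLY; count-neutral helper (`--supports stmt-HodgeConjecture-24833 --as helper`).  Currency (CONVENTIONS 08:40Z, MEMO v2 §0):
`r_c V := (restrictUnipotentGL F c V).Coinvariants` with the normalised action `normalizedJacquetGL F c V` of the Levi `Π a, GL {i // c i = a} F`, and for the Borel
label `id : Fin N → Fin N` (torus `LB N`, COMMUTATIVE ★ `levi_id_mul_comm`) the MULTIPLICITY of `η : LB N → ℂ` is
`mult V η := finrank ℂ ↥(⨅ m, maxGenEigenspace (normalizedJacquetGL F id V m) (η m))` (written inline; no definition).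

* §1 (any label `c : Fin n → Fin r`) the functor `r_c` on maps: `jacquetGLMap` intertwines the NORMALISED actions (`jacquetGLMap_normalizedJacquetGL`), is exact in the middle
  (`jacquetGLMap_exact`, transport of ★ `jacquetMap_exact` along ★ `jacquetGLEquiv`), and along `N ↪ V ↠ V ⁄ N` (`V` smooth, `c` monotone): injective ∕ exact ∕ surjective;
  `r_c N`, `r_c (V ⁄ N)` finite-dimensional when `r_c V` is; `r_c` of a `Representation.Equiv` is a linear equivalence (`exists_linearEquiv_jacquet_of_equiv`).
* §2 (Borel label) the torus acts by pairwise commuting operators (`commute_normalizedJacquetGL_id`); **`finrank_weightSpace_eq_add_subrepresentation`**: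
  `mult V η = mult N.toRepresentation η + mult N.quotientRep η` (★ E1a `finrank_weightSpace_eq_add_of_exact`); corollaries `…_subrepresentation_le`, `…_quotientRep_le`,
  and invariance under `Representation.Equiv` (`finrank_weightSpace_eq_of_equiv`, ★ E1a `finrank_weightSpace_eq_of_linearEquiv`).

HONEST LABEL: HC_CM is proved only modulo the 7 printed citations (2 remaining named inputs: hLiu418 = stmt-HodgeConjecture-24832, h413 =
stmt-HodgeConjecture-24833) until rung 0 closes; count-neutral helper.

## References
* [BernsteinZelevinsky1977] I. N. Bernstein, A. V. Zelevinsky, *Induced representations of reductive p-adic groups I*, Ann. Sci. ÉNS 10 (1977), Prop. 1.9 (a), §2.3, Cor. 2.13 (c).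
* [Casselman1995] W. Casselman, *Introduction to the theory of admissible representations of p-adic reductive groups* (draft 1995), Prop. 3.2.3, §4.4 p. 45.
* [Waldspurger2003] J.-L. Waldspurger, *La formule de Plancherel pour les groupes p-adiques*, J. Inst. Math. Jussieu 2 (2003), III.1.
-/

set_option autoImplicit false
-- the mandated namespace repeats `HodgeConjecture.HodgeConjecture`, as in every `Theorems/*.lean` of this sub-problem
set_option linter.dupNamespace false

noncomputable section

open Representation Module Function Literature.NumberTheory.Automorphic Literature.NumberTheory.GaloisRepresentations.IsNonarchimedeanLocalField
open Literature.RepresentationTheory.FiniteGroups Literature.RepresentationTheory.Semisimple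
open scoped MatrixGroups
open Summit.HodgeConjecture.HodgeConjecture.Cruxes.H413.K2E3JacquetExponentMultiset
open Summit.HodgeConjecture.HodgeConjecture.Cruxes.H413.K2E3GLnPrincipalBlockEmbedding

namespace Summit.HodgeConjecture.HodgeConjecture.Cruxes.H413.K2E3GL3JacquetMultiplicityAdditive

/-! ## §1 The Jacquet functor `r_c` on maps: normalised equivariance, exactness, finite-dimensionality -/

section Functor

variable {F : Type*} [Field F] [ValuativeRel F] [TopologicalSpace F] [IsNonarchimedeanLocalField F] {n r : ℕ} {c : Fin n → Fin r}
  {V₁ V₂ V₃ : Type*} [AddCommGroup V₁] [Module ℂ V₁] [AddCommGroup V₂] [Module ℂ V₂] [AddCommGroup V₃] [Module ℂ V₃]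
  {ρ₁ : Representation ℂ (GL (Fin n) F) V₁} {ρ₂ : Representation ℂ (GL (Fin n) F) V₂} {ρ₃ : Representation ℂ (GL (Fin n) F) V₃}

/-- **`r_c(f)` intertwines the NORMALISED Jacquet actions** (the twist by `δ^{-1∕2} ∘ leviEmbeddingP` is the same scalar on both sides). [cite: BernsteinZelevinsky1977, §2.3] -/
theorem jacquetGLMap_normalizedJacquetGL (f : ρ₁.IntertwiningMap ρ₂) (m : Π a, GL {i // c i = a} F) (x : (restrictUnipotentGL F c ρ₁).Coinvariants) :
    jacquetGLMap F c f (normalizedJacquetGL F c ρ₁ m x) = normalizedJacquetGL F c ρ₂ m (jacquetGLMap F c f x) := by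
  obtain ⟨v, rfl⟩ := Coinvariants.mk_surjective _ x
  rw [normalizedJacquetGL_mk, map_smul, jacquetGLMap_mk, jacquetGLMap_mk, normalizedJacquetGL_mk, f.isIntertwining]

omit [ValuativeRel F] [TopologicalSpace F] [IsNonarchimedeanLocalField F] in
/-- **`r_c` is exact in the middle**: for `f : ρ₁ → ρ₂`, `g : ρ₂ ↠ ρ₃` with `range f = ker g`, `range r_c(f) = ker r_c(g)` (★ `jacquetMap_exact` transported along ★ `jacquetGLEquiv`,
which is the identity on representatives). [cite: BernsteinZelevinsky1977, Prop. 1.9 (a)] [cite: Casselman1995, Prop. 3.2.3] -/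
theorem jacquetGLMap_exact [ValuativeRel F] (f : ρ₁.IntertwiningMap ρ₂) (g : ρ₂.IntertwiningMap ρ₃) (hfg : Function.Exact f g) (hg : Function.Surjective g) :
    Function.Exact (jacquetGLMap F c f) (jacquetGLMap F c g) := by
  have key := jacquetMap_exact (parabolicTripleGL F c) f g hfg hg
  intro y
  obtain ⟨v, rfl⟩ := Coinvariants.mk_surjective _ y
  constructor
  · intro hy
    have h1 : jacquetMap (parabolicTripleGL F c) g (jacquetGLEquiv F c ρ₂ (Coinvariants.mk (restrictUnipotentGL F c ρ₂) v)) = 0 := by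
      have h := congrArg (jacquetGLEquiv F c ρ₃) hy
      rw [map_zero] at h
      exact h
    obtain ⟨x', hx'⟩ := (key _).1 h1
    obtain ⟨x, rfl⟩ := (EquivLike.surjective (jacquetGLEquiv F c ρ₁)) x'
    obtain ⟨w, rfl⟩ := Coinvariants.mk_surjective _ x
    refine ⟨Coinvariants.mk (restrictUnipotentGL F c ρ₁) w, ?_⟩
    apply EquivLike.injective (jacquetGLEquiv F c ρ₂)
    exact hx'
  · rintro ⟨x, hx⟩
    obtain ⟨w, rfl⟩ := Coinvariants.mk_surjective _ x
    rw [← hx, jacquetGLMap_mk, jacquetGLMap_mk, hfg.apply_apply_eq_zero, map_zero]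

variable (ρ₂) in
omit [ValuativeRel F] [TopologicalSpace F] [IsNonarchimedeanLocalField F] in
/-- The inclusion `N ↪ V` and the projection `V ↠ V ⁄ N` form an exact pair of intertwining maps. [folklore] -/
theorem exact_subtype_mkQ (N : Subrepresentation ρ₂) : Function.Exact (Subrepresentation.subtypeIntertwiningMap N) N.mkQ := by
  intro v
  rw [Subrepresentation.mkQ_eq_zero_iff]
  constructor
  · intro hv; exact ⟨⟨v, hv⟩, rfl⟩
  · rintro ⟨w, rfl⟩; exact w.2

variable (ρ₂) in
/-- **`r_c(N ↪ V)` is injective** for `V` smooth and `c` monotone (★ `jacquetGLMap_injective`). [cite: BernsteinZelevinsky1977, Prop. 1.9 (a)] -/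
theorem jacquetGLMap_subtype_injective (hc : Monotone c) (h₂ : ρ₂.IsSmooth) (N : Subrepresentation ρ₂) :
    Function.Injective (jacquetGLMap F c (Subrepresentation.subtypeIntertwiningMap N)) :=
  jacquetGLMap_injective hc h₂ _ (Subrepresentation.subtypeIntertwiningMap_injective N)

variable (ρ₂) in
omit [TopologicalSpace F] [IsNonarchimedeanLocalField F] in
/-- **`r_c(N ↪ V)`, `r_c(V ↠ V ⁄ N)` are exact in the middle.** [cite: BernsteinZelevinsky1977, Prop. 1.9 (a)] -/
theorem jacquetGLMap_subtype_mkQ_exact (N : Subrepresentation ρ₂) :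
    Function.Exact (jacquetGLMap F c (Subrepresentation.subtypeIntertwiningMap N)) (jacquetGLMap F c N.mkQ) :=
  jacquetGLMap_exact _ _ (exact_subtype_mkQ ρ₂ N) N.mkQ_surjective

variable (ρ₂) in
omit [ValuativeRel F] [TopologicalSpace F] [IsNonarchimedeanLocalField F] in
/-- **`r_c(V ↠ V ⁄ N)` is surjective.** [folklore] -/
theorem jacquetGLMap_mkQ_surjective [ValuativeRel F] (N : Subrepresentation ρ₂) : Function.Surjective (jacquetGLMap F c N.mkQ) :=
  jacquetGLMap_surjective _ N.mkQ_surjective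

variable (ρ₂) in
/-- `r_c N` is finite-dimensional when `r_c V` is (`V` smooth, `c` monotone). [cite: BernsteinZelevinsky1977, Prop. 1.9 (a)] -/
theorem finiteDimensional_jacquet_subrepresentation (hc : Monotone c) (h₂ : ρ₂.IsSmooth) [FiniteDimensional ℂ (restrictUnipotentGL F c ρ₂).Coinvariants]
    (N : Subrepresentation ρ₂) : FiniteDimensional ℂ (restrictUnipotentGL F c N.toRepresentation).Coinvariants :=
  Module.Finite.of_injective (jacquetGLMap F c (Subrepresentation.subtypeIntertwiningMap N)).toLinearMap (jacquetGLMap_subtype_injective ρ₂ hc h₂ N)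

variable (ρ₂) in
omit [ValuativeRel F] [TopologicalSpace F] [IsNonarchimedeanLocalField F] in
/-- `r_c (V ⁄ N)` is finite-dimensional when `r_c V` is. [folklore] -/
theorem finiteDimensional_jacquet_quotientRep [ValuativeRel F] [FiniteDimensional ℂ (restrictUnipotentGL F c ρ₂).Coinvariants] (N : Subrepresentation ρ₂) :
    FiniteDimensional ℂ (restrictUnipotentGL F c N.quotientRep).Coinvariants :=
  Module.Finite.of_surjective (jacquetGLMap F c N.mkQ).toLinearMap (jacquetGLMap_mkQ_surjective ρ₂ N)

omit [ValuativeRel F] [TopologicalSpace F] [IsNonarchimedeanLocalField F] in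
/-- **`r_c` of an isomorphism is a linear isomorphism intertwining the normalised actions.** [cite: BernsteinZelevinsky1977, §2.3] -/
theorem exists_linearEquiv_jacquet_of_equiv [ValuativeRel F] [TopologicalSpace F] [IsNonarchimedeanLocalField F] (e : ρ₁.Equiv ρ₂) :
    ∃ E : (restrictUnipotentGL F c ρ₁).Coinvariants ≃ₗ[ℂ] (restrictUnipotentGL F c ρ₂).Coinvariants,
      (∀ x, E x = jacquetGLMap F c e.toIntertwiningMap x) ∧ ∀ m x, E (normalizedJacquetGL F c ρ₁ m x) = normalizedJacquetGL F c ρ₂ m (E x) := by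
  have hinj : Function.Injective (jacquetGLMap F c e.toIntertwiningMap) := by
    refine Function.LeftInverse.injective (g := jacquetGLMap F c e.symm.toIntertwiningMap) fun x => ?_
    obtain ⟨v, rfl⟩ := Coinvariants.mk_surjective _ x
    rw [jacquetGLMap_mk, jacquetGLMap_mk, Representation.Equiv.coe_toIntertwiningMap, Representation.Equiv.coe_toIntertwiningMap, Representation.Equiv.symm_apply_apply]
  have hsurj : Function.Surjective (jacquetGLMap F c e.toIntertwiningMap) :=
    jacquetGLMap_surjective _ (by rw [Representation.Equiv.coe_toIntertwiningMap]; exact EquivLike.surjective e)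
  exact ⟨LinearEquiv.ofBijective (jacquetGLMap F c e.toIntertwiningMap).toLinearMap ⟨hinj, hsurj⟩, fun _ => rfl,
    fun m x => jacquetGLMap_normalizedJacquetGL e.toIntertwiningMap m x⟩

end Functor

/-! ## §2 The Borel label: commuting torus, ADDITIVITY of multiplicities, monotonicity, invariance -/

section Borel

universe v

variable {F : Type*} [Field F] [ValuativeRel F] [TopologicalSpace F] [IsNonarchimedeanLocalField F] {N : ℕ}
  {V V' : Type v} [AddCommGroup V] [Module ℂ V] [AddCommGroup V'] [Module ℂ V'] (ρ : Representation ℂ (GL (Fin N) F) V) (ρ' : Representation ℂ (GL (Fin N) F) V')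

/-- **The torus acts on `r_B V` by pairwise COMMUTING operators** (★ `levi_id_mul_comm`). [folklore] -/
theorem commute_normalizedJacquetGL_id (m m' : Π a : Fin N, GL {i : Fin N // (id : Fin N → Fin N) i = a} F) :
    Commute (normalizedJacquetGL F (id : Fin N → Fin N) ρ m) (normalizedJacquetGL F (id : Fin N → Fin N) ρ m') := by
  rw [Commute, SemiconjBy, ← map_mul, levi_id_mul_comm, map_mul]

/-- **ADDITIVITY OF JACQUET MULTIPLICITIES**: for `V` smooth with `r_B V` finite-dimensional and a subrepresentation `N`, for every `η : LB N → ℂ`,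
`mult V η = mult N η + mult (V ⁄ N) η` — the exact sequence `0 → r_B N → r_B V → r_B (V ⁄ N) → 0` (§1) fed to ★ E1a `finrank_weightSpace_eq_add_of_exact`.
[cite: BernsteinZelevinsky1977, Cor. 2.13 (c), Prop. 1.9 (a)] [cite: Waldspurger2003, III.1] [cite: Casselman1995, §4.4 p. 45] -/
theorem finrank_weightSpace_eq_add_subrepresentation (hρ : ρ.IsSmooth) [FiniteDimensional ℂ (restrictUnipotentGL F (id : Fin N → Fin N) ρ).Coinvariants]
    (S : Subrepresentation ρ) (η : (Π a : Fin N, GL {i : Fin N // (id : Fin N → Fin N) i = a} F) → ℂ) :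
    finrank ℂ ↥(⨅ m, Module.End.maxGenEigenspace (normalizedJacquetGL F (id : Fin N → Fin N) ρ m) (η m)) =
      finrank ℂ ↥(⨅ m, Module.End.maxGenEigenspace (normalizedJacquetGL F (id : Fin N → Fin N) S.toRepresentation m) (η m)) +
        finrank ℂ ↥(⨅ m, Module.End.maxGenEigenspace (normalizedJacquetGL F (id : Fin N → Fin N) S.quotientRep m) (η m)) :=
  finrank_weightSpace_eq_add_of_exact (normalizedJacquetGL F (id : Fin N → Fin N) S.toRepresentation) (normalizedJacquetGL F (id : Fin N → Fin N) ρ)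
    (normalizedJacquetGL F (id : Fin N → Fin N) S.quotientRep) (commute_normalizedJacquetGL_id ρ) (commute_normalizedJacquetGL_id S.quotientRep)
    (jacquetGLMap F (id : Fin N → Fin N) (Subrepresentation.subtypeIntertwiningMap S)).toLinearMap (jacquetGLMap F (id : Fin N → Fin N) S.mkQ).toLinearMap
    (fun m x => jacquetGLMap_normalizedJacquetGL _ m x) (fun m x => jacquetGLMap_normalizedJacquetGL _ m x)
    (jacquetGLMap_subtype_injective ρ monotone_id hρ S) (jacquetGLMap_subtype_mkQ_exact ρ S) (jacquetGLMap_mkQ_surjective ρ S) η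

/-- **Monotonicity under subrepresentations**: `mult N η ≤ mult V η`. [cite: BernsteinZelevinsky1977, Cor. 2.13 (c)] -/
theorem finrank_weightSpace_subrepresentation_le (hρ : ρ.IsSmooth) [FiniteDimensional ℂ (restrictUnipotentGL F (id : Fin N → Fin N) ρ).Coinvariants]
    (S : Subrepresentation ρ) (η : (Π a : Fin N, GL {i : Fin N // (id : Fin N → Fin N) i = a} F) → ℂ) :
    finrank ℂ ↥(⨅ m, Module.End.maxGenEigenspace (normalizedJacquetGL F (id : Fin N → Fin N) S.toRepresentation m) (η m)) ≤
      finrank ℂ ↥(⨅ m, Module.End.maxGenEigenspace (normalizedJacquetGL F (id : Fin N → Fin N) ρ m) (η m)) := by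
  rw [finrank_weightSpace_eq_add_subrepresentation ρ hρ S η]; exact Nat.le_add_right _ _

/-- **Monotonicity under quotients**: `mult (V ⁄ N) η ≤ mult V η`. [cite: BernsteinZelevinsky1977, Cor. 2.13 (c)] -/
theorem finrank_weightSpace_quotientRep_le (hρ : ρ.IsSmooth) [FiniteDimensional ℂ (restrictUnipotentGL F (id : Fin N → Fin N) ρ).Coinvariants]
    (S : Subrepresentation ρ) (η : (Π a : Fin N, GL {i : Fin N // (id : Fin N → Fin N) i = a} F) → ℂ) :
    finrank ℂ ↥(⨅ m, Module.End.maxGenEigenspace (normalizedJacquetGL F (id : Fin N → Fin N) S.quotientRep m) (η m)) ≤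
      finrank ℂ ↥(⨅ m, Module.End.maxGenEigenspace (normalizedJacquetGL F (id : Fin N → Fin N) ρ m) (η m)) := by
  rw [finrank_weightSpace_eq_add_subrepresentation ρ hρ S η]; exact Nat.le_add_left _ _

/-- **`r_B N` and `r_B (V ⁄ N)` are finite-dimensional** when `r_B V` is (`V` smooth). [cite: BernsteinZelevinsky1977, Prop. 1.9 (a)] -/
theorem finiteDimensional_jacquet_sub_and_quotient (hρ : ρ.IsSmooth) [FiniteDimensional ℂ (restrictUnipotentGL F (id : Fin N → Fin N) ρ).Coinvariants]
    (S : Subrepresentation ρ) :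
    FiniteDimensional ℂ (restrictUnipotentGL F (id : Fin N → Fin N) S.toRepresentation).Coinvariants ∧
      FiniteDimensional ℂ (restrictUnipotentGL F (id : Fin N → Fin N) S.quotientRep).Coinvariants :=
  ⟨finiteDimensional_jacquet_subrepresentation ρ monotone_id hρ S, finiteDimensional_jacquet_quotientRep ρ S⟩

/-- **Invariance of multiplicities under isomorphism** (any label): `ρ ≃ ρ' ⇒ mult ρ η = mult ρ' η`. [cite: BernsteinZelevinsky1977, §2.3] -/
theorem finrank_weightSpace_eq_of_equiv {r : ℕ} {c : Fin N → Fin r} (e : ρ.Equiv ρ') (η : (Π a : Fin r, GL {i : Fin N // c i = a} F) → ℂ) :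
    finrank ℂ ↥(⨅ m, Module.End.maxGenEigenspace (normalizedJacquetGL F c ρ m) (η m)) =
      finrank ℂ ↥(⨅ m, Module.End.maxGenEigenspace (normalizedJacquetGL F c ρ' m) (η m)) := by
  obtain ⟨E, -, hE⟩ := exists_linearEquiv_jacquet_of_equiv (c := c) e
  exact finrank_weightSpace_eq_of_linearEquiv _ _ E hE η

/-- Transport of finite-dimensionality of `r_c` along an isomorphism. [folklore] -/
theorem finiteDimensional_jacquet_of_equiv {r : ℕ} {c : Fin N → Fin r} (e : ρ.Equiv ρ') [FiniteDimensional ℂ (restrictUnipotentGL F c ρ).Coinvariants] :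
    FiniteDimensional ℂ (restrictUnipotentGL F c ρ').Coinvariants := by
  obtain ⟨E, -, -⟩ := exists_linearEquiv_jacquet_of_equiv (c := c) e
  exact LinearEquiv.finiteDimensional E

/-- **Sub-subquotient bookkeeping**: for `S ≤ V` and `T ≤ S` (a subrepresentation of `S.toRepresentation`), `mult V η = mult T η + mult (S ⁄ T) η + mult (V ⁄ S) η`.
[cite: BernsteinZelevinsky1977, Cor. 2.13 (c)] -/
theorem finrank_weightSpace_eq_add_add (hρ : ρ.IsSmooth) [FiniteDimensional ℂ (restrictUnipotentGL F (id : Fin N → Fin N) ρ).Coinvariants]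
    (S : Subrepresentation ρ) (T : Subrepresentation S.toRepresentation) (η : (Π a : Fin N, GL {i : Fin N // (id : Fin N → Fin N) i = a} F) → ℂ) :
    finrank ℂ ↥(⨅ m, Module.End.maxGenEigenspace (normalizedJacquetGL F (id : Fin N → Fin N) ρ m) (η m)) =
      finrank ℂ ↥(⨅ m, Module.End.maxGenEigenspace (normalizedJacquetGL F (id : Fin N → Fin N) T.toRepresentation m) (η m)) +
        finrank ℂ ↥(⨅ m, Module.End.maxGenEigenspace (normalizedJacquetGL F (id : Fin N → Fin N) T.quotientRep m) (η m)) +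
        finrank ℂ ↥(⨅ m, Module.End.maxGenEigenspace (normalizedJacquetGL F (id : Fin N → Fin N) S.quotientRep m) (η m)) := by
  haveI := finiteDimensional_jacquet_subrepresentation ρ monotone_id hρ S
  rw [finrank_weightSpace_eq_add_subrepresentation ρ hρ S η, finrank_weightSpace_eq_add_subrepresentation S.toRepresentation (hρ.toRepresentation S) T η]

end Borel

end Summit.HodgeConjecture.HodgeConjecture.Cruxes.H413.K2E3GL3JacquetMultiplicityAdditive

end
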